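import Summits.CriticalPhenomena.PercolationContinuityZ3.Theorems.FK.InfiniteVolumeDLRBoxKernel
import HarnessLib

/-!
# FK-continuity transplant, FO-06 (construction half): Grimmett's Lemma (4.13) EXACT for the box laws, summed
# over events — the conditional law inside a region is the specification kernel, read inside `Λ_m` off `D_m(Λ)`

Cell `fk-continuity` (bschramm), row FO-06b-6; support file for the FK-continuity transplant
(`--supports stmt-CriticalPhenomena-4575`); builds on p205010 (kernel theorem, internal audit signed;
external expert review pending). No named facts, no sorries, standard axioms. General dimension `d`, both `b`.

* `rcBoxLaw_real_eq_sum_sum_indicator` — the box law of an event of `ℤ^d` as a double sum over the outside /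
  inside patterns of the box configuration relative to the region;
* `sum_powerset_eq_sum_sum_union`, `sum_powerset_ite_mem_cylEvent`, `mem_cylEvent_iff_eq_filter` — bookkeeping;
* `rcWeight_union_div_eq_sum_ite` — the kernel identity for one outside pattern (from
  `InfiniteVolumeDLRBoxKernel.rcWeight_union_eq_rcCondProb_mul_sum`);
* **`rcBoxLaw_real_cylEvent_inter_inter_compl_regionBadEvent_eq_sum`** — for `Λ ⊆ Λ_m`, `m + 1 ≤ n`, `η ⊆ E_Λ` and
  `H` determined by pairs off `E_Λ`:
  `φ^b_{Λ_n}({ω ∩ E_Λ = η} ∩ H ∖ D_m(Λ)) = ∑_ζ φ^{ζ}_{Λ,p,q}(η) · φ^b_{Λ_n}(H ∖ D_m(Λ) ∩ {ω = ζ on Λ_m² ∖ E_Λ})`, the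
  sum over the finitely many patterns `ζ` on the pairs of `Λ_m` off `E_Λ` — the form that passes to the limit
  `n → ∞` term by term (`InfiniteVolumeDLREquation.lean`).

## References

* G. Grimmett, *The Random-Cluster Model*, Springer 2006: §4.2 (4.11)–(4.13), Lemma (4.13) p. 71; Lemma (4.39)
  p. 83; proof of Thm. (4.31) eq. (4.45). [Grimmett2006]
-/

noncomputable section

open MeasureTheory Set Filter
open scoped Topology ENNReal

namespace Summit.CriticalPhenomena.PercolationContinuityZ3.Theorems.FK

open Literature.Probability.Percolation Literature.Probability.LatticeModels

variable {d : ℕ}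

/-! ### The exact conditional law of the box measures, in kernel form, read inside `Λ_m` -/

section Main

open Finset

variable {b : Bool} {p q : ℝ} {n m : ℕ} {Λ : Finset (Site d)}

/-- Membership in a cylinder event picks out one pattern: `χ ∈ cylEvent E' ζ` iff `ζ` is the pattern of `χ` on
`E'` (`ζ ⊆ E'`). [cite: Grimmett2006, §4.1] -/
theorem mem_cylEvent_iff_eq_filter {ι : Type*} [DecidableEq ι] {E' ζ : Finset ι} (hζ : ζ ⊆ E') (χ : Set ι)
    [DecidablePred (· ∈ χ)] : χ ∈ cylEvent E' ζ ↔ E'.filter (· ∈ χ) = ζ := by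
  rw [mem_cylEvent_iff]
  constructor
  · intro h
    ext i
    simp only [Finset.mem_filter]
    exact ⟨fun ⟨hi, hiχ⟩ => (h i hi).1 hiχ, fun hiζ => ⟨hζ hiζ, (h i (hζ hiζ)).2 hiζ⟩⟩
  · intro h i hi
    rw [← h, Finset.mem_filter]
    exact ⟨fun hiχ => ⟨hi, hiχ⟩, fun h' => h'.2⟩

open Classical in
/-- A sum over the patterns `ζ ⊆ E'` against the indicator of `χ ∈ cylEvent E' ζ` has one term. [folklore] -/
theorem sum_powerset_ite_mem_cylEvent {ι M : Type*} [AddCommMonoid M] (E' : Finset ι) (χ : Set ι)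
    (c : Finset ι → M) :
    ∑ ζ ∈ E'.powerset, (if χ ∈ cylEvent E' ζ then c ζ else 0) = c (E'.filter (· ∈ χ)) := by
  have hmem : E'.filter (· ∈ χ) ∈ E'.powerset := Finset.mem_powerset.2 (Finset.filter_subset _ _)
  rw [Finset.sum_eq_single_of_mem _ hmem]
  · rw [if_pos ((mem_cylEvent_iff_eq_filter (Finset.filter_subset _ E') χ).2 rfl)]
  · intro ζ hζ hne
    rw [if_neg]
    intro h'
    exact hne ((mem_cylEvent_iff_eq_filter (Finset.mem_powerset.1 hζ) χ).1 h').symm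

/-- **Block decomposition of a sum over configurations**: `ω ⊆ E` is uniquely `ι ∪ ξ` with `ι ⊆ U` and
`ξ ⊆ E ∖ U`. [folklore] -/
theorem sum_powerset_eq_sum_sum_union {α M : Type*} [DecidableEq α] [AddCommMonoid M] {E U : Finset α}
    (hU : U ⊆ E) (F : Finset α → M) :
    ∑ ω ∈ E.powerset, F ω = ∑ ξ ∈ (E \ U).powerset, ∑ ι ∈ U.powerset, F (ι ∪ ξ) := by
  have hprod : ∑ x ∈ (E \ U).powerset ×ˢ U.powerset, F (x.2 ∪ x.1) =
      ∑ ξ ∈ (E \ U).powerset, ∑ ι ∈ U.powerset, F (ι ∪ ξ) := by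
    rw [Finset.sum_product]
  rw [← hprod]
  have hsplit : ∀ ω : Finset α, ω ∩ U ∪ ω \ U = ω := fun ω => by
    rw [Finset.union_comm, Finset.sdiff_union_inter]
  refine Finset.sum_nbij' (fun ω => (ω \ U, ω ∩ U)) (fun x => x.2 ∪ x.1) ?_ ?_ ?_ ?_ ?_
  · intro ω hω
    rw [Finset.mem_powerset] at hω
    exact Finset.mem_product.2 ⟨Finset.mem_powerset.2 (Finset.sdiff_subset_sdiff hω le_rfl),
      Finset.mem_powerset.2 Finset.inter_subset_right⟩
  · rintro ⟨ξ, ι⟩ hx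
    obtain ⟨hξ, hι⟩ := Finset.mem_product.1 hx
    rw [Finset.mem_powerset] at hξ hι ⊢
    exact Finset.union_subset (hι.trans hU) (hξ.trans Finset.sdiff_subset)
  · intro ω _
    exact hsplit ω
  · rintro ⟨ξ, ι⟩ hx
    obtain ⟨hξ, hι⟩ := Finset.mem_product.1 hx
    rw [Finset.mem_powerset] at hξ hι
    have hξU : Disjoint ξ U := Finset.disjoint_left.2 fun e he heU => (Finset.mem_sdiff.1 (hξ he)).2 heU
    simp only [Prod.mk.injEq]
    constructor
    · rw [Finset.union_sdiff_distrib, Finset.sdiff_eq_empty_iff_subset.2 hι, Finset.empty_union,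
        hξU.sdiff_eq_left]
    · rw [Finset.union_inter_distrib_right, Finset.inter_eq_left.2 hι, Finset.disjoint_iff_inter_eq_empty.1 hξU,
        Finset.union_empty]
  · intro ω _
    simp only
    rw [hsplit ω]

/-- The lift of a box configuration `ι ∪ ξ` (`ι` inside, `ξ` off the inside edges of `Λ`) lies in the cylinder
`{ω ∩ E_Λ = η}` iff `ι` is the box copy of `η`. [cite: Grimmett2006, §4.2] -/
theorem liftEdges_union_mem_cylEvent_iff (hΛn : Λ ⊆ box d n) {η : Finset (Sym2 (Site d))}
    (hη : η ⊆ edgesIn (zdGraph d) Λ) {ι ξ : Finset (Sym2 ↥(box d n))} (hι : ι ⊆ insideEdges (zdGraph d) hΛn)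
    (hξ : Disjoint ξ (insideEdges (zdGraph d) hΛn)) :
    liftEdges (box d n) (↑(ι ∪ ξ) : BondConfig ↥(box d n)) ∈ cylEvent (edgesIn (zdGraph d) Λ) η ↔
      ι.image (Sym2.map Subtype.val) = η := by
  classical
  have hinter := liftEdges_coe_union_inter_eq hΛn hι hξ
  rw [mem_cylEvent_iff]
  constructor
  · intro h
    rw [← Finset.coe_inj, ← hinter]
    ext e
    simp only [Set.mem_inter_iff, Finset.mem_coe]
    constructor
    · rintro ⟨he, heU⟩; exact (h e heU).1 he
    · intro heη; exact ⟨(h e (hη heη)).2 heη, hη heη⟩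
  · intro h e heU
    have := Set.ext_iff.1 hinter e
    simp only [Set.mem_inter_iff, Finset.mem_coe, h] at this
    exact ⟨fun he => (this.1 ⟨he, heU⟩), fun heη => (this.2 heη).1⟩

/-- The box law of an event of `ℤ^d`, as a double sum over the outside and inside patterns (relative to the region
`Λ ⊆ Λ_n`) of the box configuration. [cite: Grimmett2006, §4.2 (4.12)] -/
theorem rcBoxLaw_real_eq_sum_sum_indicator (b : Bool) (hp : p ∈ Set.Icc (0 : ℝ) 1) (hq : 0 < q)
    (hΛn : Λ ⊆ box d n) {Y : Set (BondConfig (Site d))} (hY : MeasurableSet Y) :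
    (rcBoxLaw d b p q n).real Y =
      ∑ ξ ∈ ((finsetGraph (zdGraph d) (box d n)).edgeFinset \ insideEdges (zdGraph d) hΛn).powerset,
        ∑ ι ∈ (insideEdges (zdGraph d) hΛn).powerset,
          Y.indicator (fun _ => rcWeight (finsetGraph (zdGraph d) (box d n)) p q (boxBC d b n) (ι ∪ ξ) /
            rcPartitionFunction (finsetGraph (zdGraph d) (box d n)) p q (boxBC d b n))
            (liftEdges (box d n) (↑(ι ∪ ξ) : BondConfig ↥(box d n))) := by
  classical
  rw [rcBoxLaw_real_apply b p q n hY, rcBoxMeasure, rcMeasure_real_apply _ hp hq,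
    sum_powerset_eq_sum_sum_union (insideEdges_subset_edgeFinset hΛn)]
  refine Finset.sum_congr rfl fun ξ _ => Finset.sum_congr rfl fun ι _ => ?_
  rw [Set.indicator_apply]
  exact if_congr Iff.rfl rfl rfl

/-- For an outside pattern `ξ` of the box (off the inside edges of `Λ`) and an inside pattern `ι`: the lift of
`ι ∪ ξ` belongs to an event not seeing `E_Λ` iff the lift of `ξ` does. [folklore] -/
theorem liftEdges_union_mem_iff_of_forall (hΛn : Λ ⊆ box d n) {X : Set (BondConfig (Site d))}
    (hX : ∀ χ, χ ∈ X ↔ χ \ ↑(edgesIn (zdGraph d) Λ) ∈ X) {ι ξ : Finset (Sym2 ↥(box d n))}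
    (hι : ι ⊆ insideEdges (zdGraph d) hΛn) (hξ : Disjoint ξ (insideEdges (zdGraph d) hΛn)) :
    liftEdges (box d n) (↑(ι ∪ ξ) : BondConfig ↥(box d n)) ∈ X ↔ liftEdges (box d n) (↑ξ : BondConfig ↥(box d n)) ∈ X := by
  rw [hX, liftEdges_coe_union_sdiff_eq hΛn hι hξ, ← liftEdges_sdiff_edgesIn_of_disjoint hΛn hξ, ← hX]

open Classical in
/-- LEFT inner sum: over the inside patterns, the indicator of `{ω ∩ E_Λ = η} ∩ H ∖ D_m(Λ)` keeps the single
term `ι = η'` (the box copy of `η`). [cite: Grimmett2006, Lemma (4.13)] -/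
theorem sum_indicator_cylEvent_inter_eq (hΛn : Λ ⊆ box d n) {η : Finset (Sym2 (Site d))}
    (hη : η ⊆ edgesIn (zdGraph d) Λ) {η' : Finset (Sym2 ↥(box d n))} (hη'U : η' ⊆ insideEdges (zdGraph d) hΛn)
    (hη'img : η'.image (Sym2.map Subtype.val) = η) {H : Set (BondConfig (Site d))}
    (hH : ∀ χ, χ ∈ H ↔ χ \ ↑(edgesIn (zdGraph d) Λ) ∈ H) {Bad : Set (BondConfig (Site d))}
    (hBad : ∀ χ, χ ∈ Bad ↔ χ \ ↑(edgesIn (zdGraph d) Λ) ∈ Bad) {ξ : Finset (Sym2 ↥(box d n))}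
    (hξ : Disjoint ξ (insideEdges (zdGraph d) hΛn)) (F : Finset (Sym2 ↥(box d n)) → ℝ) :
    ∑ ι ∈ (insideEdges (zdGraph d) hΛn).powerset,
        (cylEvent (edgesIn (zdGraph d) Λ) η ∩ H ∩ Badᶜ).indicator (fun _ => F (ι ∪ ξ))
          (liftEdges (box d n) (↑(ι ∪ ξ) : BondConfig ↥(box d n))) =
      if liftEdges (box d n) (↑ξ : BondConfig ↥(box d n)) ∈ H ∧ liftEdges (box d n) (↑ξ : BondConfig ↥(box d n)) ∉ Bad
      then F (η' ∪ ξ) else 0 := by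
  set L := liftEdges (box d n) with hL
  have himg_iff : ∀ {ι}, ι ⊆ insideEdges (zdGraph d) hΛn → (ι.image (Sym2.map Subtype.val) = η ↔ ι = η') := by
    intro ι _
    constructor
    · intro h
      rw [← hη'img] at h
      exact Finset.image_injective (Sym2.map.injective (Subtype.val_injective (p := fun x : Site d => x ∈ box d n))) h
    · rintro rfl; exact hη'img
  have hterm : ∀ ι ∈ (insideEdges (zdGraph d) hΛn).powerset,
      (cylEvent (edgesIn (zdGraph d) Λ) η ∩ H ∩ Badᶜ).indicator (fun _ => F (ι ∪ ξ)) (L ↑(ι ∪ ξ)) =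
        if L ↑ξ ∈ H ∧ L ↑ξ ∉ Bad then (if η' = ι then F (ι ∪ ξ) else 0) else 0 := by
    intro ι hι
    have hι' := Finset.mem_powerset.1 hι
    have hC : L ↑(ι ∪ ξ) ∈ cylEvent (edgesIn (zdGraph d) Λ) η ↔ ι = η' := by
      rw [← himg_iff hι']
      exact liftEdges_union_mem_cylEvent_iff hΛn hη hι' hξ
    have hHiff := liftEdges_union_mem_iff_of_forall hΛn hH hι' hξ
    have hBiff := liftEdges_union_mem_iff_of_forall hΛn hBad hι' hξ
    by_cases hmem : L ↑(ι ∪ ξ) ∈ cylEvent (edgesIn (zdGraph d) Λ) η ∩ H ∩ Badᶜ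
    · rw [Set.indicator_of_mem hmem]
      obtain ⟨⟨h1, h2⟩, h3⟩ := hmem
      rw [if_pos ⟨hHiff.1 h2, fun h => h3 (hBiff.2 h)⟩, if_pos (hC.1 h1).symm]
    · rw [Set.indicator_of_notMem hmem]
      by_cases h2 : L ↑ξ ∈ H ∧ L ↑ξ ∉ Bad
      · rw [if_pos h2, if_neg]
        rintro rfl
        exact hmem ⟨⟨hC.2 rfl, hHiff.2 h2.1⟩, fun h => h2.2 (hBiff.1 h)⟩
      · rw [if_neg h2]
  rw [Finset.sum_congr rfl hterm]
  split_ifs with h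
  · rw [Finset.sum_ite_eq (insideEdges (zdGraph d) hΛn).powerset η', if_pos (Finset.mem_powerset.2 hη'U)]
  · simp

open Classical in
/-- RIGHT inner sum: over the inside patterns, the indicator of `H ∖ D_m(Λ) ∩ {cylinder over E'}` is constant.
[cite: Grimmett2006, Lemma (4.13)] -/
theorem sum_indicator_inter_cylEvent_eq (hΛn : Λ ⊆ box d n) {E' : Finset (Sym2 (Site d))}
    (hE' : Disjoint E' (edgesIn (zdGraph d) Λ)) (ζ : Finset (Sym2 (Site d))) {H : Set (BondConfig (Site d))}
    (hH : ∀ χ, χ ∈ H ↔ χ \ ↑(edgesIn (zdGraph d) Λ) ∈ H) {Bad : Set (BondConfig (Site d))}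
    (hBad : ∀ χ, χ ∈ Bad ↔ χ \ ↑(edgesIn (zdGraph d) Λ) ∈ Bad) {ξ : Finset (Sym2 ↥(box d n))}
    (hξ : Disjoint ξ (insideEdges (zdGraph d) hΛn)) (F : Finset (Sym2 ↥(box d n)) → ℝ) :
    ∑ ι ∈ (insideEdges (zdGraph d) hΛn).powerset,
        (H ∩ Badᶜ ∩ cylEvent E' ζ).indicator (fun _ => F (ι ∪ ξ))
          (liftEdges (box d n) (↑(ι ∪ ξ) : BondConfig ↥(box d n))) =
      if liftEdges (box d n) (↑ξ : BondConfig ↥(box d n)) ∈ H ∧ liftEdges (box d n) (↑ξ : BondConfig ↥(box d n)) ∉ Bad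
      then (if liftEdges (box d n) (↑ξ : BondConfig ↥(box d n)) ∈ cylEvent E' ζ
        then ∑ ι ∈ (insideEdges (zdGraph d) hΛn).powerset, F (ι ∪ ξ) else 0) else 0 := by
  set L := liftEdges (box d n) with hL
  have hterm : ∀ ι ∈ (insideEdges (zdGraph d) hΛn).powerset,
      (H ∩ Badᶜ ∩ cylEvent E' ζ).indicator (fun _ => F (ι ∪ ξ)) (L ↑(ι ∪ ξ)) =
        if L ↑ξ ∈ H ∧ L ↑ξ ∉ Bad then (if L ↑ξ ∈ cylEvent E' ζ then F (ι ∪ ξ) else 0) else 0 := by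
    intro ι hι
    have hι' := Finset.mem_powerset.1 hι
    have hHiff := liftEdges_union_mem_iff_of_forall hΛn hH hι' hξ
    have hBiff := liftEdges_union_mem_iff_of_forall hΛn hBad hι' hξ
    have hCiff := liftEdges_union_mem_iff_of_forall hΛn (mem_cylEvent_iff_sdiff_mem hE' ζ) hι' hξ
    by_cases hmem : L ↑(ι ∪ ξ) ∈ H ∩ Badᶜ ∩ cylEvent E' ζ
    · rw [Set.indicator_of_mem hmem]
      obtain ⟨⟨h1, h2⟩, h3⟩ := hmem
      rw [if_pos ⟨hHiff.1 h1, fun h => h2 (hBiff.2 h)⟩, if_pos (hCiff.1 h3)]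
    · rw [Set.indicator_of_notMem hmem]
      by_cases h2 : L ↑ξ ∈ H ∧ L ↑ξ ∉ Bad
      · rw [if_pos h2, if_neg]
        intro h3
        exact hmem ⟨⟨hHiff.2 h2.1, fun h => h2.2 (hBiff.1 h)⟩, hCiff.2 h3⟩
      · rw [if_neg h2]
  rw [Finset.sum_congr rfl hterm]
  split_ifs <;> simp

/-- The pattern of a configuration on `Λ_m² ∖ E_Λ`, read as an environment, gives the kernel at the configuration
read inside `Λ_m`. [cite: Grimmett2006, §4.2 (4.12)] -/
theorem rcCondProb_coe_filter_mem_eq (Λ : Finset (Site d)) (m : ℕ) (χ : BondConfig (Site d))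
    [DecidablePred (· ∈ χ)] (η : Finset (Sym2 (Site d))) :
    rcCondProb p q Λ ↑(((box d m).sym2 \ edgesIn (zdGraph d) Λ).filter (· ∈ χ)) η =
      rcCondProb p q Λ (χ ∩ ↑((box d m).sym2)) η := by
  refine rcCondProb_congr_sdiff ?_ η
  ext e
  simp only [Set.mem_sdiff, Finset.mem_coe, Finset.mem_filter, Finset.mem_sdiff, Set.mem_inter_iff]
  constructor
  · rintro ⟨⟨⟨hem, -⟩, heχ⟩, heU⟩
    exact ⟨⟨heχ, hem⟩, heU⟩
  · rintro ⟨⟨heχ, hem⟩, heU⟩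
    exact ⟨⟨⟨hem, heU⟩, heχ⟩, heU⟩

open Classical in
/-- **The kernel identity for one outside pattern** (Grimmett's Lemma (4.13) at a configuration `ξ` of
`E_{Λ_n} ∖ E_Λ` off the bad event, read inside `Λ_m`): the weight of `η' ∪ ξ` is the kernel at the local pattern
of `ξ` times the total weight of the cylinder of `ξ`. [cite: Grimmett2006, Lemma (4.13) with Lemma (4.39)] -/
theorem rcWeight_union_div_eq_sum_ite (b : Bool) (hp : p ∈ Set.Icc (0 : ℝ) 1) (hq : 0 < q) (hmn : m + 1 ≤ n)
    (hΛm : Λ ⊆ box d m) (hΛn : Λ ⊆ box d n) {η : Finset (Sym2 (Site d))} {η' : Finset (Sym2 ↥(box d n))}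
    (hη'U : η' ⊆ insideEdges (zdGraph d) hΛn) (hη'img : η'.image (Sym2.map Subtype.val) = η)
    {ξ : Finset (Sym2 ↥(box d n))} (hξE : ξ ⊆ (finsetGraph (zdGraph d) (box d n)).edgeFinset)
    (hξ : Disjoint ξ (insideEdges (zdGraph d) hΛn))
    (hgood : liftEdges (box d n) (↑ξ : BondConfig ↥(box d n)) ∉ regionBadEvent Λ m) (Z : ℝ) :
    rcWeight (finsetGraph (zdGraph d) (box d n)) p q (boxBC d b n) (η' ∪ ξ) / Z =
      ∑ ζ ∈ ((box d m).sym2 \ edgesIn (zdGraph d) Λ).powerset, rcCondProb p q Λ ↑ζ η *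
        (if liftEdges (box d n) (↑ξ : BondConfig ↥(box d n)) ∈ cylEvent ((box d m).sym2 \ edgesIn (zdGraph d) Λ) ζ
          then ∑ ι ∈ (insideEdges (zdGraph d) hΛn).powerset,
            rcWeight (finsetGraph (zdGraph d) (box d n)) p q (boxBC d b n) (ι ∪ ξ) / Z else 0) := by
  set E' := (box d m).sym2 \ edgesIn (zdGraph d) Λ with hE'
  set L := liftEdges (box d n) with hL
  have hswap : ∀ ζ ∈ E'.powerset, rcCondProb p q Λ ↑ζ η *
      (if L ↑ξ ∈ cylEvent E' ζ then ∑ ι ∈ (insideEdges (zdGraph d) hΛn).powerset,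
        rcWeight (finsetGraph (zdGraph d) (box d n)) p q (boxBC d b n) (ι ∪ ξ) / Z else 0) =
      if L ↑ξ ∈ cylEvent E' ζ then rcCondProb p q Λ ↑ζ η * ∑ ι ∈ (insideEdges (zdGraph d) hΛn).powerset,
        rcWeight (finsetGraph (zdGraph d) (box d n)) p q (boxBC d b n) (ι ∪ ξ) / Z else 0 := by
    intro ζ _
    split_ifs
    · rfl
    · rw [mul_zero]
  rw [Finset.sum_congr rfl hswap, sum_powerset_ite_mem_cylEvent E' (L ↑ξ), rcCondProb_coe_filter_mem_eq,
    ← hη'img, ← Finset.sum_div, ← mul_div_assoc,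
    ← rcWeight_union_eq_rcCondProb_mul_sum hp hq hmn hΛm hΛn b hξE hξ hgood hη'U]

/-- **Grimmett's Lemma (4.13), exact, for the box laws, read inside `Λ_m`** (kernel form summed over the local
patterns): for `Λ ⊆ Λ_m`, `m + 1 ≤ n`, an inside pattern `η ⊆ E_Λ`, and an event `H` determined by pairs off
`E_Λ`,
`φ^b_{Λ_n}({ω ∩ E_Λ = η} ∩ H ∖ D_m(Λ)) = ∑_{ζ ⊆ Λ_m² ∖ E_Λ} φ^{ζ}_{Λ,p,q}(η) · φ^b_{Λ_n}(H ∖ D_m(Λ) ∩ {ω = ζ on Λ_m² ∖ E_Λ})`: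
conditionally on the configuration off `E_Λ` (and off the bad event, where the induced boundary condition is
read inside `Λ_m`), the pattern inside is distributed by the specification kernel (`0 ≤ p ≤ 1`, `q > 0`).
[cite: Grimmett2006, Lemma (4.13) with Lemma (4.39); proof of Thm. (4.31) eq. (4.45)] -/
theorem rcBoxLaw_real_cylEvent_inter_inter_compl_regionBadEvent_eq_sum (b : Bool) (hp : p ∈ Set.Icc (0 : ℝ) 1)
    (hq : 0 < q) (hmn : m + 1 ≤ n) (hΛm : Λ ⊆ box d m) {η : Finset (Sym2 (Site d))}
    (hη : η ⊆ edgesIn (zdGraph d) Λ) {H : Set (BondConfig (Site d))} {T : Set (Sym2 (Site d))}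
    (hH : DeterminedBy H T) (hTU : Disjoint T ↑(edgesIn (zdGraph d) Λ)) (hHm : MeasurableSet H) :
    (rcBoxLaw d b p q n).real (cylEvent (edgesIn (zdGraph d) Λ) η ∩ H ∩ (regionBadEvent Λ m)ᶜ) =
      ∑ ζ ∈ ((box d m).sym2 \ edgesIn (zdGraph d) Λ).powerset, rcCondProb p q Λ ↑ζ η *
        (rcBoxLaw d b p q n).real
          (H ∩ (regionBadEvent Λ m)ᶜ ∩ cylEvent ((box d m).sym2 \ edgesIn (zdGraph d) Λ) ζ) := by
  classical
  have hΛn : Λ ⊆ box d n := hΛm.trans (box_mono d ((Nat.le_succ m).trans hmn))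
  set U := edgesIn (zdGraph d) Λ with hU
  set U' := insideEdges (zdGraph d) hΛn with hU'
  set E' := (box d m).sym2 \ U with hE'
  set L := liftEdges (box d n) with hL
  have hE'U : Disjoint E' U := Finset.sdiff_disjoint
  have hBm : MeasurableSet (regionBadEvent Λ m) := measurableSet_regionBadEvent Λ m
  have hHoff : ∀ χ, χ ∈ H ↔ χ \ ↑U ∈ H := mem_iff_sdiff_mem_of_determinedBy hH hTU
  have hBoff : ∀ χ, χ ∈ regionBadEvent Λ m ↔ χ \ ↑U ∈ regionBadEvent Λ m :=
    mem_regionBadEvent_iff_sdiff_mem Λ m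
  have hdisj : ∀ {ξ}, ξ ∈ ((finsetGraph (zdGraph d) (box d n)).edgeFinset \ U').powerset → Disjoint ξ U' :=
    fun hξ => Finset.disjoint_left.2 fun e he heU => (Finset.mem_sdiff.1 (Finset.mem_powerset.1 hξ he)).2 heU
  have hξE : ∀ {ξ}, ξ ∈ ((finsetGraph (zdGraph d) (box d n)).edgeFinset \ U').powerset →
      ξ ⊆ (finsetGraph (zdGraph d) (box d n)).edgeFinset :=
    fun hξ => (Finset.mem_powerset.1 hξ).trans Finset.sdiff_subset
  -- the box copy `η'` of `η`
  set η' := U'.filter (fun e => Sym2.map Subtype.val e ∈ η) with hη'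
  have hη'U : η' ⊆ U' := Finset.filter_subset _ _
  have hη'img : η'.image (Sym2.map Subtype.val) = η := by
    ext e
    rw [Finset.mem_image]
    constructor
    · rintro ⟨e', he', rfl⟩
      exact (Finset.mem_filter.1 he').2
    · intro he
      have he' : e ∈ U'.image (Sym2.map Subtype.val) := by rw [image_insideEdges_eq_edgesIn hΛn]; exact hη he
      obtain ⟨e₀, he₀, rfl⟩ := Finset.mem_image.1 he'
      exact ⟨e₀, Finset.mem_filter.2 ⟨he₀, he⟩, rfl⟩
  -- measurability
  have hmeasL : MeasurableSet (cylEvent U η ∩ H ∩ (regionBadEvent Λ m)ᶜ) :=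
    ((measurableSet_cylEvent U η).inter hHm).inter hBm.compl
  have hmeasR : ∀ ζ, MeasurableSet (H ∩ (regionBadEvent Λ m)ᶜ ∩ cylEvent E' ζ) := fun ζ =>
    (hHm.inter hBm.compl).inter (measurableSet_cylEvent E' ζ)
  -- both sides as sums over the outside patterns `ξ`
  set W : Finset (Sym2 ↥(box d n)) → ℝ := fun ω =>
    rcWeight (finsetGraph (zdGraph d) (box d n)) p q (boxBC d b n) ω /
      rcPartitionFunction (finsetGraph (zdGraph d) (box d n)) p q (boxBC d b n) with hW
  have hLHS : (rcBoxLaw d b p q n).real (cylEvent U η ∩ H ∩ (regionBadEvent Λ m)ᶜ) =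
      ∑ ξ ∈ ((finsetGraph (zdGraph d) (box d n)).edgeFinset \ U').powerset,
        if L ↑ξ ∈ H ∧ L ↑ξ ∉ regionBadEvent Λ m then W (η' ∪ ξ) else 0 := by
    rw [rcBoxLaw_real_eq_sum_sum_indicator b hp hq hΛn hmeasL]
    exact Finset.sum_congr rfl fun ξ hξ =>
      sum_indicator_cylEvent_inter_eq hΛn hη hη'U hη'img hHoff hBoff (hdisj hξ) W
  have hRHS : ∀ ζ, (rcBoxLaw d b p q n).real (H ∩ (regionBadEvent Λ m)ᶜ ∩ cylEvent E' ζ) =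
      ∑ ξ ∈ ((finsetGraph (zdGraph d) (box d n)).edgeFinset \ U').powerset,
        if L ↑ξ ∈ H ∧ L ↑ξ ∉ regionBadEvent Λ m then
          (if L ↑ξ ∈ cylEvent E' ζ then ∑ ι ∈ U'.powerset, W (ι ∪ ξ) else 0) else 0 := by
    intro ζ
    rw [rcBoxLaw_real_eq_sum_sum_indicator b hp hq hΛn (hmeasR ζ)]
    exact Finset.sum_congr rfl fun ξ hξ =>
      sum_indicator_inter_cylEvent_eq hΛn hE'U ζ hHoff hBoff (hdisj hξ) W
  have hRHS' : (∑ ζ ∈ E'.powerset, rcCondProb p q Λ ↑ζ η *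
      (rcBoxLaw d b p q n).real (H ∩ (regionBadEvent Λ m)ᶜ ∩ cylEvent E' ζ)) =
      ∑ ζ ∈ E'.powerset, ∑ ξ ∈ ((finsetGraph (zdGraph d) (box d n)).edgeFinset \ U').powerset,
        rcCondProb p q Λ ↑ζ η * (if L ↑ξ ∈ H ∧ L ↑ξ ∉ regionBadEvent Λ m then
          (if L ↑ξ ∈ cylEvent E' ζ then ∑ ι ∈ U'.powerset, W (ι ∪ ξ) else 0) else 0) :=
    Finset.sum_congr rfl fun ζ _ => by rw [hRHS ζ, Finset.mul_sum]
  rw [hLHS, hRHS', Finset.sum_comm]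
  refine Finset.sum_congr rfl fun ξ hξ => ?_
  by_cases hgoodξ : L ↑ξ ∈ H ∧ L ↑ξ ∉ regionBadEvent Λ m
  · rw [if_pos hgoodξ, Finset.sum_congr rfl fun ζ _ => by rw [if_pos hgoodξ]]
    exact rcWeight_union_div_eq_sum_ite b hp hq hmn hΛm hΛn hη'U hη'img (hξE hξ) (hdisj hξ) hgoodξ.2 _
  · rw [if_neg hgoodξ, Finset.sum_congr rfl fun ζ _ => by rw [if_neg hgoodξ, mul_zero], Finset.sum_const_zero]

end Main


end Summit.CriticalPhenomena.PercolationContinuityZ3.Theorems.FK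

end
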